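import Summits.AtomisticToContinuum.BoseEinsteinCondensation.Theses.BECStronglyRayleigh
import Literature.MathematicalPhysics.QuantumLattice.DuhamelTwoPoint
import HarnessLib

/-!
# Spectral mapping for the Gibbs weight: stub `stub_spectralMapping` of line
# `stable-cone-variational-selection` for crux `GroundStateStability` (stmt-AtomisticToContinuum-9672)

Stub E2 of the skeleton `Cruxes/GroundStateStability/Lines/stable-cone-variational-selection.lean`:
for a Hermitian matrix `H` on a finite index type and a real `τ ≠ 0`, every eigenvector `φ` of the
Gibbs weight `e^{-τH}` (`Matrix.gibbsWeight τ H`) is an eigenvector of `H`.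

Proof. Write `H = U diag(λᵢ) U⋆` and `e^{-τH} = U diag(e^{-τλᵢ}) U⋆`
(`Matrix.IsHermitian.eq_conj_diagonal`, `Matrix.IsHermitian.gibbsWeight_eq`) and put `ψ = U⋆ φ`,
so that `φ = U ψ` and `ψ ≠ 0`. The eigen-equation reads `e^{-τλᵢ} ψᵢ = c ψᵢ` for all `i`; picking
`i₀` with `ψ_{i₀} ≠ 0`, every `i` with `ψᵢ ≠ 0` has `e^{-τλᵢ} = c = e^{-τλ_{i₀}}`, hence
`λᵢ = λ_{i₀}` because `t ↦ e^{-τt}` is injective for `τ ≠ 0`. Therefore `diag(λ) ψ = λ_{i₀} ψ`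
and `H φ = U diag(λ) ψ = λ_{i₀} U ψ = λ_{i₀} φ`. The linear algebra is isolated in
`specMap_eigvec_of_conj_diagonal` (two matrices simultaneously conjugate-diagonalised by `U`, the
second diagonal a "function" of the first).
-/

noncomputable section

namespace Summit.AtomisticToContinuum.BoseEinsteinCondensation.Cruxes.GroundStateStability.StableConeVariationalSelection

open scoped BigOperators Matrix ComplexOrder
open Literature.MathematicalPhysics.QuantumLattice
open Matrix

/-- **Eigenvectors of a diagonal matrix are eigenvectors of any diagonal matrix it determines.**
If `diag(e) ψ = c ψ` with `ψ ≠ 0` and `e i = e j → d i = d j`, then `diag(d) ψ = d i₀ • ψ` for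
some index `i₀` (any index in the support of `ψ`). [folklore] -/
theorem specMap_diagonal_mulVec_eq_smul {ι : Type*} [Fintype ι] [DecidableEq ι] (d e : ι → ℂ)
    (hde : ∀ i j, e i = e j → d i = d j) {ψ : ι → ℂ} {c : ℂ} (hψ : ψ ≠ 0)
    (h : diagonal e *ᵥ ψ = c • ψ) : ∃ i₀, diagonal d *ᵥ ψ = d i₀ • ψ := by
  obtain ⟨i₀, hi₀⟩ := Function.ne_iff.mp hψ
  have hpt : ∀ i, e i * ψ i = c * ψ i := fun i => by
    have := congrFun h i
    rwa [mulVec_diagonal, Pi.smul_apply, smul_eq_mul] at this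
  have he₀ : e i₀ = c := mul_right_cancel₀ hi₀ (hpt i₀)
  refine ⟨i₀, funext fun i => ?_⟩
  rw [mulVec_diagonal, Pi.smul_apply, smul_eq_mul]
  by_cases hi : ψ i = 0
  · rw [hi, mul_zero, mul_zero]
  · rw [hde i i₀ ((mul_right_cancel₀ hi (hpt i)).trans he₀.symm)]

/-- **Simultaneous conjugate diagonalisation transports eigenvectors.** If `U⋆U = UU⋆ = 1`,
`H = U diag(d) U⋆`, `T = U diag(e) U⋆` and `e i = e j → d i = d j`, then every eigenvector of `T`
is an eigenvector of `H`. [folklore] -/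
theorem specMap_eigvec_of_conj_diagonal {ι : Type*} [Fintype ι] [DecidableEq ι] (U : Matrix ι ι ℂ)
    (hUl : star U * U = 1) (hUr : U * star U = 1) (d e : ι → ℂ) {H T : Matrix ι ι ℂ}
    (hH : H = U * diagonal d * star U) (hT : T = U * diagonal e * star U)
    (hde : ∀ i j, e i = e j → d i = d j) {φ : ι → ℂ} {c : ℂ} (hφ : φ ≠ 0)
    (h : T *ᵥ φ = c • φ) : ∃ E : ℂ, H *ᵥ φ = E • φ := by
  subst hH hT
  have hφψ : φ = U *ᵥ (star U *ᵥ φ) := by rw [mulVec_mulVec, hUr, one_mulVec]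
  have hψ : star U *ᵥ φ ≠ 0 := fun h0 => hφ (by rw [hφψ, h0, mulVec_zero])
  have hD : diagonal e *ᵥ (star U *ᵥ φ) = c • (star U *ᵥ φ) := by
    have h2 : star U *ᵥ ((U * diagonal e * star U) *ᵥ φ) = star U *ᵥ (c • φ) := by rw [h]
    rwa [mulVec_smul, mulVec_mulVec, ← Matrix.mul_assoc, ← Matrix.mul_assoc, hUl, Matrix.one_mul,
      ← mulVec_mulVec] at h2
  obtain ⟨i₀, hi₀⟩ := specMap_diagonal_mulVec_eq_smul d e hde hψ hD
  refine ⟨d i₀, ?_⟩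
  calc (U * diagonal d * star U) *ᵥ φ = U *ᵥ (diagonal d *ᵥ (star U *ᵥ φ)) := by
        rw [mulVec_mulVec, mulVec_mulVec]
    _ = d i₀ • φ := by rw [hi₀, mulVec_smul, ← hφψ]

/-- For `τ ≠ 0` the map `t ↦ e^{-τt}` (read in `ℂ`) is injective on the eigenvalue list:
`e^{-τλᵢ} = e^{-τλⱼ} → λᵢ = λⱼ`. [folklore] -/
theorem specMap_exp_inj {ι : Type*} {τ : ℝ} (hτ : τ ≠ 0) (lam : ι → ℝ) (i j : ι)
    (h : (Real.exp (-(τ * lam i)) : ℂ) = (Real.exp (-(τ * lam j)) : ℂ)) :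
    (lam i : ℂ) = (lam j : ℂ) := by
  have h1 : Real.exp (-(τ * lam i)) = Real.exp (-(τ * lam j)) := by exact_mod_cast h
  rw [mul_left_cancel₀ hτ (neg_inj.mp (Real.exp_eq_exp.mp h1))]

/-- **Stub E2 — spectral mapping for the Gibbs weight.** For a Hermitian matrix `H` on a finite
index type and `τ ≠ 0`, every eigenvector of `e^{-τH}` is an eigenvector of `H`:
`e^{-τH} = U diag(e^{-τλᵢ}) U⋆` (`Matrix.IsHermitian.gibbsWeight_eq`), and `t ↦ e^{-τt}` is
injective, so all eigenvalues `λᵢ` carrying the vector coincide. [folklore] -/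
theorem stub_spectralMapping :
    ∀ (ι : Type) [Fintype ι] [DecidableEq ι] (H : Matrix ι ι ℂ), H.IsHermitian → ∀ τ : ℝ, τ ≠ 0 →
      ∀ (φ : ι → ℂ) (c : ℂ), φ ≠ 0 → Matrix.gibbsWeight τ H *ᵥ φ = c • φ →
        ∃ E : ℂ, H *ᵥ φ = E • φ := by
  intro ι _ _ H hH τ hτ φ c hφ hTφ
  have hUm : (hH.eigenvectorUnitary : Matrix ι ι ℂ) ∈ unitary (Matrix ι ι ℂ) :=
    hH.eigenvectorUnitary.prop
  exact specMap_eigvec_of_conj_diagonal (hH.eigenvectorUnitary : Matrix ι ι ℂ)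
    (Unitary.star_mul_self_of_mem hUm) (Unitary.mul_star_self_of_mem hUm)
    (fun i => (hH.eigenvalues i : ℂ)) (fun i => (Real.exp (-(τ * hH.eigenvalues i)) : ℂ))
    hH.eq_conj_diagonal (hH.gibbsWeight_eq τ) (specMap_exp_inj hτ hH.eigenvalues) hφ hTφ

end Summit.AtomisticToContinuum.BoseEinsteinCondensation.Cruxes.GroundStateStability.StableConeVariationalSelection
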